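import Summits.Ventures.PercRepro.MSTightProj

/-!
# Conjecture (T) at a tightening direction without partner members forces tiny sides

Dossier proofs/MINE1-theoremS.md, Addendum 48 §7. Let `F` have Marica–Schönheim excess one and let
`r` be a tightening direction (`proj r F` tight) with NO partner members (`partner r F = ∅`, i.e.
no set appears both with and without `r`). Then `|X ∩ Y| = |K| + 1 = 1`, so if Conjecture (T) holds
at `r` (`Y ⊆ X`) then `|Y| = 1`, and Daykin's inequality `|F₁| |F₀| ≤ |Y| |F₀ \\ F₁| ≤ |X| = |F|`
gives `|F₁| · |F₀| ≤ |F₀| + |F₁|`, i.e. `(|F₀| − 1)(|F₁| − 1) ≤ 1`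
(`card_partr_mul_card_part0_le_of_partner_eq_empty`). So at a partner-free tightening direction,
(T) is possible only when one side is a single member or both sides have two — consistent with
the census (13,788 such configurations on [6], all with (T)).
-/

namespace PercRepro.MSTight

open Finset
open scoped FinsetFamily

variable {α : Type*} [DecidableEq α] {r : α} {F : Finset (Finset α)}

/-- At a tightening direction of an excess-one family without partner members, `|X ∩ Y| = 1`. -/
theorem card_diffsX_inter_diffsY_of_partner_eq_empty (hex : (F \\ F).card = F.card + 1)
    (hP : Tight (proj r F)) (hK : partner r F = ∅) :
    (diffsX r F ∩ diffsY r F).card = 1 := by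
  have h1 := card_diffs_eq_card_diffs_proj_add r F
  have h2 := card_eq_card_proj_add_card_partner r F
  rw [hK, card_empty] at h2
  unfold Tight at hP
  omega

/-- At a tightening direction of an excess-one family without partner members, Conjecture (T)
(`Y ⊆ X`) forces `|Y| = 1`. -/
theorem card_diffsY_eq_one_of_partner_eq_empty (hex : (F \\ F).card = F.card + 1)
    (hP : Tight (proj r F)) (hK : partner r F = ∅) (hT : diffsY r F ⊆ diffsX r F) :
    (diffsY r F).card = 1 := by
  have h := card_diffsX_inter_diffsY_of_partner_eq_empty hex hP hK
  rwa [inter_eq_right.2 hT] at h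

/-- **Tiny sides.** At a tightening direction of an excess-one family without partner members,
Conjecture (T) gives `|F₁| · |F₀| ≤ |F₀| + |F₁|` (Daykin's inequality with `|Y| = 1` and
`F₀ \\ F₁ ⊆ X`, `|X| = |F|`). -/
theorem card_partr_mul_card_part0_le_of_partner_eq_empty (hex : (F \\ F).card = F.card + 1)
    (hP : Tight (proj r F)) (hK : partner r F = ∅) (hT : diffsY r F ⊆ diffsX r F) :
    (partr r F).card * (part0 r F).card ≤ (part0 r F).card + (partr r F).card := by
  have hY := card_diffsY_eq_one_of_partner_eq_empty hex hP hK hT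
  have hD := le_card_diffs_mul_card_diffs (partr r F) (part0 r F)
  have hXY := card_diffs_eq_card_X_add_card_Y r F
  have hsub : part0 r F \\ partr r F ⊆ diffsX r F := by
    unfold diffsX
    exact subset_union_right
  have hXle := card_le_card hsub
  have hF := card_eq_card_proj_add_card_partner r F
  rw [hK, card_empty, proj_eq_union] at hF
  have hU := card_union_le (part0 r F) (partr r F)
  unfold diffsY at hY
  rw [hY, one_mul] at hD
  unfold diffsY at hXY
  omega

end PercRepro.MSTight
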